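import Summits.QuantumFields.YangMills.Theorems.UnitScaleTiltProp7FibreTrueLinDefect
import HarnessLib

/-!
# Route `UnitScaleTilt`, crux K1 «MinimiserStabilityRegPr» (stmt-QuantumFields-19200), route-R [RP] curved, the `Q`-junction (R2), file C —
# THE WALK MASSES READ IN THE BRICKS' TWO-BLOCK NEIGHBOURHOODS: ON THE (0.4)-FIBRE
# `√Σ_c‖T^{(k)}Y(c)‖² ≤ E_k·S_k + 2√d·Σ_{j<k}C_CM·E_j·S_j`, `S_j = 260·(d+2)L·√((2dL^d)(2d))·Σ_{i<j}ρ^{j−1−i}·μ_i·‖Y_i‖_{ℓ²}` — SUP × `ℓ²`-MASS of the level ratios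

Cell `ym3-torus`, keyed width hand `ym-routeR-w3` (D-0154 (3c); (R2) LOCATED 2026-08-28 08:42Z).  Sequel of file B ✓ `…FibreTrueLinDefect`.  THEOREMS ONLY (0 `def`,
0 `sorry`); `--supports stmt-QuantumFields-19200`, count-neutral.  YM₃ on T³ is a ladder rung (R3), not the Clay problem; nothing here claims the stub, the crux, d = 4 or the gap.

THE POINT.  File B displays per-level walk masses `m_j(c)` of the level ratios `Y_j = pertVar Ū₀^{(j)}W̄^{(j)}` along the (0.4) walks at `c`.  ★w2-20520 g3's brick
✓ p607412 `Prop7TrueLinDefectBound` already located every such walk in the two-block neighbourhood `N(c) = {b : blockOf b₋ ∈ {c₋, c₊}}` (`mass_loop_le`, `mass_segment_le`: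
mass `≤ (d+2)L·Σ_{b∈N(c)}‖Y_j(b)‖`; `#N(c) ≤ 2dL^d`, multiplicity `2d`: `card_nbhd_le`, `sum_nbhd_le`).  Reading `m_j(c) := (d+2)L·Σ_{N(c)}‖Y_j‖` there: the walk-mass
hypotheses of file B DISAPPEAR, and `√(Σ_c m_j(c)⁴) ≤ μ_j·(d+2)L·√((2dL^d)(2d))·√(Σ_b‖Y_j(b)‖²)` for ANY per-level bound `μ_j ≥ (d+2)L·Σ_{N(c)}‖Y_j‖` (Cauchy–Schwarz on `N(c)`,
multiplicity) — the «sup × mean» form: ONE sup-type factor `μ_j` (smallness `72μ_j ≤ 1`, `3μ_j + a_j < δ_N`) times the `ℓ²` MASS of the level-`j` ratio field.  What stays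
displayed: `μ_j` and `‖Y_j‖_{ℓ²}` (suppliers: the two-field∕cut-off sup row of ✓ p609586's technique, `≈ 2(d+1)L^jρ`, and the interior mean-value input `C_reg` of
✓ p609586 §4 — ★w1-19200 g6's (S3′) row), the tower sizes of ★routeR-w2's `tower_plaq_lt` regime.

WHAT IS PROVED (ns `…Theorems.Prop7FibreTrueLinDefectMass`; `SU(N)`, any `P`, `k ≤ m + K`).
* §1 `sqrt_sum_pow_four_le`, `sum_sq_nbhdMass_le`, `sqrt_sum_nbhdMass_pow_four_le` — the `ℓ⁴ ≤ sup·ℓ²` and two-block Cauchy–Schwarz bookkeeping.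
* §2 ★★★ `sqrt_sum_normSq_trueLinIter_le_of_iter_eq_mass` — file B's bound with the walk masses discharged in `N(c)` and the sup × mass reading.
HONEST SCOPE.  Bookkeeping; nothing of [Balaban1985Averaging] is asserted beyond the cited tree theorems.

References: T. Bałaban, CMP 98 (1985) 17–51 [Balaban1985Averaging] (Prop. 3 (122)–(126) p.36, (19)–(20) p.21); CMP 109 (1987) 249–301 [Balaban1987RG1] ((0.3)–(0.4) pp.252–253);
CMP 102 (1985) 277–309 [Balaban1985Variational] ((15) p.280, Prop. 7 p.299).
-/

set_option autoImplicit false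

noncomputable section

open scoped BigOperators Matrix.Norms.L2Operator

namespace Summit.QuantumFields.YangMills.Theorems.Prop7FibreTrueLinDefectMass

open Literature.MathematicalPhysics.QuantumFieldTheory.Balaban1983to89
open Finset T4Continuum BlockAveraging AveragingRT ExpMeanLog BlockAveragingEMLLinearised BlockAveragingEMLLinearisedBackground BlockAveragingEMLProp2
open Summit.QuantumFields.YangMills.Theorems.Prop7TrueLinDefectBound (mass_loop_le mass_segment_le card_nbhd_le sum_nbhd_le)
open Summit.QuantumFields.YangMills.Theorems.Prop7FibreTrueLinDefect (sqrt_sum_normSq_trueLinIter_le_of_iter_eq)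

variable {P : Params} {N : ℕ} [NeZero N]

/-! ## §1 `ℓ⁴ ≤ sup × ℓ²` and the two-block Cauchy–Schwarz -/

omit [NeZero N] in
/-- `√(Σ m⁴) ≤ μ·√(Σ m²)` when `0 ≤ m ≤ μ` termwise. [folklore] -/
theorem sqrt_sum_pow_four_le {ι : Type*} (s : Finset ι) (m : ι → ℝ) {μ : ℝ} (hm0 : ∀ i ∈ s, 0 ≤ m i) (hm : ∀ i ∈ s, m i ≤ μ) :
    Real.sqrt (∑ i ∈ s, m i ^ 4) ≤ μ * Real.sqrt (∑ i ∈ s, m i ^ 2) := by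
  by_cases hs : s = ∅
  · simp [hs]
  obtain ⟨i₀, hi₀⟩ := Finset.nonempty_iff_ne_empty.mpr hs
  have hμ : 0 ≤ μ := (hm0 i₀ hi₀).trans (hm i₀ hi₀)
  have h : ∑ i ∈ s, m i ^ 4 ≤ μ ^ 2 * ∑ i ∈ s, m i ^ 2 := by
    rw [Finset.mul_sum]
    refine Finset.sum_le_sum fun i hi => ?_
    have h1 : m i ^ 2 ≤ μ ^ 2 := pow_le_pow_left₀ (hm0 i hi) (hm i hi) 2
    nlinarith [sq_nonneg (m i)]
  calc Real.sqrt (∑ i ∈ s, m i ^ 4) ≤ Real.sqrt (μ ^ 2 * ∑ i ∈ s, m i ^ 2) := Real.sqrt_le_sqrt h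
    _ = μ * Real.sqrt (∑ i ∈ s, m i ^ 2) := by rw [Real.sqrt_mul (sq_nonneg _), Real.sqrt_sq hμ]

omit [NeZero N] in
/-- **TWO-BLOCK CAUCHY–SCHWARZ WITH MULTIPLICITY**: `Σ_c ((d+2)L·Σ_{b∈N(c)}‖Z b‖)² ≤ ((d+2)L)²·(2dL^d)·(2d)·Σ_b‖Z b‖²`.
[cite: Balaban1987RG1, (0.3)-(0.4) pp.252-253] -/
theorem sum_sq_nbhdMass_le {j : ℕ} (hj : j + 1 ≤ P.m + P.K) (Z : PBond P j → Matrix (Fin N) (Fin N) ℂ) :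
    ∑ c : PBond P (j + 1), ((((P.d + 2) * P.L : ℕ) : ℝ) * ∑ b ∈ (univ.filter (fun b : PBond P j => blockOf b.src = c.src ∨ blockOf b.src = c.tgt)), ‖Z b‖) ^ 2
      ≤ (((P.d + 2) * P.L : ℕ) : ℝ) ^ 2 * (2 * P.d * (P.L : ℝ) ^ P.d) * (2 * P.d) * ∑ b : PBond P j, ‖Z b‖ ^ 2 := by
  have hpt : ∀ c : PBond P (j + 1), ((((P.d + 2) * P.L : ℕ) : ℝ) * ∑ b ∈ (univ.filter (fun b : PBond P j => blockOf b.src = c.src ∨ blockOf b.src = c.tgt)), ‖Z b‖) ^ 2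
      ≤ (((P.d + 2) * P.L : ℕ) : ℝ) ^ 2 * (2 * P.d * (P.L : ℝ) ^ P.d) * ∑ b ∈ (univ.filter (fun b : PBond P j => blockOf b.src = c.src ∨ blockOf b.src = c.tgt)), ‖Z b‖ ^ 2 := by
    intro c
    have hCS := sq_sum_le_card_mul_sum_sq (s := (univ.filter (fun b : PBond P j => blockOf b.src = c.src ∨ blockOf b.src = c.tgt))) (f := fun b => ‖Z b‖)
    have hcard := card_nbhd_le (P := P) hj c
    have hsq0 : 0 ≤ ∑ b ∈ (univ.filter (fun b : PBond P j => blockOf b.src = c.src ∨ blockOf b.src = c.tgt)), ‖Z b‖ ^ 2 := Finset.sum_nonneg fun b _ => sq_nonneg _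
    calc ((((P.d + 2) * P.L : ℕ) : ℝ) * ∑ b ∈ (univ.filter (fun b : PBond P j => blockOf b.src = c.src ∨ blockOf b.src = c.tgt)), ‖Z b‖) ^ 2 = (((P.d + 2) * P.L : ℕ) : ℝ) ^ 2 * (∑ b ∈ (univ.filter (fun b : PBond P j => blockOf b.src = c.src ∨ blockOf b.src = c.tgt)), ‖Z b‖) ^ 2 := by ring
      _ ≤ (((P.d + 2) * P.L : ℕ) : ℝ) ^ 2 * ((((univ.filter (fun b : PBond P j => blockOf b.src = c.src ∨ blockOf b.src = c.tgt))).card : ℝ) * ∑ b ∈ (univ.filter (fun b : PBond P j => blockOf b.src = c.src ∨ blockOf b.src = c.tgt)), ‖Z b‖ ^ 2) := mul_le_mul_of_nonneg_left hCS (sq_nonneg _)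
      _ ≤ (((P.d + 2) * P.L : ℕ) : ℝ) ^ 2 * ((2 * P.d * (P.L : ℝ) ^ P.d) * ∑ b ∈ (univ.filter (fun b : PBond P j => blockOf b.src = c.src ∨ blockOf b.src = c.tgt)), ‖Z b‖ ^ 2) :=
          mul_le_mul_of_nonneg_left (mul_le_mul_of_nonneg_right hcard hsq0) (sq_nonneg _)
      _ = _ := by ring
  calc _ ≤ ∑ c : PBond P (j + 1), (((P.d + 2) * P.L : ℕ) : ℝ) ^ 2 * (2 * P.d * (P.L : ℝ) ^ P.d) * ∑ b ∈ (univ.filter (fun b : PBond P j => blockOf b.src = c.src ∨ blockOf b.src = c.tgt)), ‖Z b‖ ^ 2 := Finset.sum_le_sum fun c _ => hpt c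
    _ = (((P.d + 2) * P.L : ℕ) : ℝ) ^ 2 * (2 * P.d * (P.L : ℝ) ^ P.d) * ∑ c : PBond P (j + 1), ∑ b ∈ (univ.filter (fun b : PBond P j => blockOf b.src = c.src ∨ blockOf b.src = c.tgt)), ‖Z b‖ ^ 2 := by rw [Finset.mul_sum]
    _ ≤ (((P.d + 2) * P.L : ℕ) : ℝ) ^ 2 * (2 * P.d * (P.L : ℝ) ^ P.d) * (2 * P.d * ∑ b : PBond P j, ‖Z b‖ ^ 2) :=
        mul_le_mul_of_nonneg_left (sum_nbhd_le (fun b => ‖Z b‖ ^ 2) fun b => sq_nonneg _) (by positivity)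
    _ = _ := by ring

omit [NeZero N] in
/-- **THE `ℓ⁴` ROW IN SUP × MASS FORM**: if `(d+2)L·Σ_{b∈N(c)}‖Z b‖ ≤ μ` at every coarse bond, then
`√(Σ_c ((d+2)L·Σ_{N(c)}‖Z‖)⁴) ≤ μ·((d+2)L·√((2dL^d)(2d))·√(Σ_b‖Z b‖²))`. [cite: Balaban1987RG1, (0.3)-(0.4) pp.252-253] -/
theorem sqrt_sum_nbhdMass_pow_four_le {j : ℕ} (hj : j + 1 ≤ P.m + P.K) (Z : PBond P j → Matrix (Fin N) (Fin N) ℂ) {μ : ℝ} (hμ0 : 0 ≤ μ)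
    (hμ : ∀ c : PBond P (j + 1), (((P.d + 2) * P.L : ℕ) : ℝ) * ∑ b ∈ (univ.filter (fun b : PBond P j => blockOf b.src = c.src ∨ blockOf b.src = c.tgt)), ‖Z b‖ ≤ μ) :
    Real.sqrt (∑ c : PBond P (j + 1), ((((P.d + 2) * P.L : ℕ) : ℝ) * ∑ b ∈ (univ.filter (fun b : PBond P j => blockOf b.src = c.src ∨ blockOf b.src = c.tgt)), ‖Z b‖) ^ 4)
      ≤ μ * ((((P.d + 2) * P.L : ℕ) : ℝ) * Real.sqrt (2 * P.d * (P.L : ℝ) ^ P.d * (2 * P.d)) * Real.sqrt (∑ b : PBond P j, ‖Z b‖ ^ 2)) := by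
  have h0 : ∀ c ∈ (Finset.univ : Finset (PBond P (j + 1))), 0 ≤ (((P.d + 2) * P.L : ℕ) : ℝ) * ∑ b ∈ (univ.filter (fun b : PBond P j => blockOf b.src = c.src ∨ blockOf b.src = c.tgt)), ‖Z b‖ :=
    fun c _ => mul_nonneg (Nat.cast_nonneg _) (Finset.sum_nonneg fun b _ => norm_nonneg _)
  have h1 := sqrt_sum_pow_four_le (Finset.univ : Finset (PBond P (j + 1))) (fun c => (((P.d + 2) * P.L : ℕ) : ℝ) * ∑ b ∈ (univ.filter (fun b : PBond P j => blockOf b.src = c.src ∨ blockOf b.src = c.tgt)), ‖Z b‖) h0 (fun c _ => hμ c)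
  refine h1.trans (mul_le_mul_of_nonneg_left ?_ hμ0)
  have h2 := Real.sqrt_le_sqrt (sum_sq_nbhdMass_le (N := N) hj Z)
  refine h2.trans (le_of_eq ?_)
  have e : (((P.d + 2) * P.L : ℕ) : ℝ) ^ 2 * (2 * P.d * (P.L : ℝ) ^ P.d) * (2 * P.d) * ∑ b : PBond P j, ‖Z b‖ ^ 2
      = (((P.d + 2) * P.L : ℕ) : ℝ) ^ 2 * ((2 * P.d * (P.L : ℝ) ^ P.d * (2 * P.d)) * ∑ b : PBond P j, ‖Z b‖ ^ 2) := by ring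
  rw [e, Real.sqrt_mul (sq_nonneg _), Real.sqrt_sq (Nat.cast_nonneg _), Real.sqrt_mul (by positivity)]
  ring

/-! ## §2 ★★★ The `Q`-junction in sup × mass form -/

/-- ★★★ **THE `Q`-JUNCTION, WALK MASSES DISCHARGED IN THE TWO-BLOCK NEIGHBOURHOODS.**  As file B's ★★★ theorem (`U₀, W ∈ SU(N)`, fibre `W̄^{(k)} = Ū₀^{(k)}`,
`k ≤ m + K`, `Q` the true linearised iterate, tower sizes `a`, `a′`), but the per-level inputs are now ANY bounds `μ_j` of the two-block masses
`(d+2)L·Σ_{b∈N(c)}‖Y_j(b)‖ ≤ μ_j` (`N(c) = {b : blockOf b₋ ∈ {c₋,c₊}}`; `72μ_j ≤ 1`, `3μ_j + a_j < δ_N`).  Then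
`√(Σ_c‖Q k (pertVar U₀ W) c‖²) ≤ E_k·S_k + 2√d·Σ_{j<k}C_CM·(E_j·S_j)`, `S_j = Σ_{i<j}ρ^{j−1−i}·260·μ_i·((d+2)L·√((2dL^d)(2d))·√(Σ_b‖Y_i(b)‖²))` — one SUP-type factor
times the `ℓ²` MASS of the level ratio field, per level, with the bricks' geometric weights. [cite: Balaban1985Averaging, Prop. 3 (122)-(126) p.36; Balaban1985Variational, Prop. 7 p.299] -/
theorem sqrt_sum_normSq_trueLinIter_le_of_iter_eq_mass (U₀ W : GaugeField P 0 (Matrix.specialUnitaryGroup (Fin N) ℂ)) {k : ℕ} (hk : k ≤ P.m + P.K)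
    (hfib : Averaging.iter (fun i => blockAvg (P := P) (j := i) (expMeanLogSU (n := Fin N))) k W = Averaging.iter (fun i => blockAvg (P := P) (j := i) (expMeanLogSU (n := Fin N))) k U₀)
    (Q : (k : ℕ) → (PBond P 0 → Matrix (Fin N) (Fin N) ℂ) → PBond P k → Matrix (Fin N) (Fin N) ℂ) (hQ0 : ∀ Y, Q 0 Y = Y)
    (hQs : ∀ (k : ℕ) (Y : PBond P 0 → Matrix (Fin N) (Fin N) ℂ) (c : PBond P (k + 1)), Q (k + 1) Y c = (fderiv ℂ (eml : (Idx P → Matrix (Fin N) (Fin N) ℂ) → Matrix (Fin N) (Fin N) ℂ)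
            (fun i => ((loopHol (Averaging.iter (fun i => blockAvg (P := P) (j := i) (expMeanLogSU (n := Fin N))) k U₀) c i : Matrix.specialUnitaryGroup (Fin N) ℂ) : Matrix (Fin N) (Fin N) ℂ))
            (fun i => covWalkSum (Averaging.iter (fun i => blockAvg (P := P) (j := i) (expMeanLogSU (n := Fin N))) k U₀) (Q k Y) (walk (emb c.src) (loopWord P.L c.dir (off i.1) i.2.1 i.2.2))
              * ((loopHol (Averaging.iter (fun i => blockAvg (P := P) (j := i) (expMeanLogSU (n := Fin N))) k U₀) c i : Matrix.specialUnitaryGroup (Fin N) ℂ) : Matrix (Fin N) (Fin N) ℂ))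
            * star ((corr (expMeanLogSU (n := Fin N)) (Averaging.iter (fun i => blockAvg (P := P) (j := i) (expMeanLogSU (n := Fin N))) k U₀) c : Matrix.specialUnitaryGroup (Fin N) ℂ) : Matrix (Fin N) (Fin N) ℂ)
          + ((corr (expMeanLogSU (n := Fin N)) (Averaging.iter (fun i => blockAvg (P := P) (j := i) (expMeanLogSU (n := Fin N))) k U₀) c : Matrix.specialUnitaryGroup (Fin N) ℂ) : Matrix (Fin N) (Fin N) ℂ)
            * covWalkSum (Averaging.iter (fun i => blockAvg (P := P) (j := i) (expMeanLogSU (n := Fin N))) k U₀) (Q k Y) (walk (emb c.src) (List.replicate P.L (c.dir, true)))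
            * star ((corr (expMeanLogSU (n := Fin N)) (Averaging.iter (fun i => blockAvg (P := P) (j := i) (expMeanLogSU (n := Fin N))) k U₀) c : Matrix.specialUnitaryGroup (Fin N) ℂ) : Matrix (Fin N) (Fin N) ℂ)))
    (a : ℕ → ℝ) (ha0 : ∀ j, 0 ≤ a j) {a' : ℝ} (ha' : 0 ≤ a')
    (hα : ∀ j < k, ∀ (c : PBond P (j + 1)) (i : Idx P), dist1 (loopHol (Averaging.iter (fun i => blockAvg (P := P) (j := i) (expMeanLogSU (n := Fin N))) j U₀) c i) ≤ a j)
    (ha24 : ∀ j < k, a j ≤ 1 / 24) (haN : ∀ j < k, a j < deltaSU (Fin N))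
    (hV : ∀ j < k, ∀ q : Plaq P j, dist1 (GaugeField.plaqHol (Averaging.iter (fun i => blockAvg (P := P) (j := i) (expMeanLogSU (n := Fin N))) j U₀) q) ≤ a')
    (μ : ℕ → ℝ) (hμ0 : ∀ j < k, 0 ≤ μ j)
    (hμ : ∀ j < k, ∀ c : PBond P (j + 1), (((P.d + 2) * P.L : ℕ) : ℝ) * ∑ b ∈ (univ.filter (fun b : PBond P j => blockOf b.src = c.src ∨ blockOf b.src = c.tgt)), ‖(pertVar (Averaging.iter (fun i => blockAvg (P := P) (j := i) (expMeanLogSU (n := Fin N))) j U₀) (Averaging.iter (fun i => blockAvg (P := P) (j := i) (expMeanLogSU (n := Fin N))) j W)) b‖ ≤ μ j)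
    (hμ72 : ∀ j < k, 72 * μ j ≤ 1) (hμN : ∀ j < k, 3 * μ j + a j < deltaSU (Fin N)) :
    Real.sqrt (∑ c : PBond P k, ‖Q k (pertVar U₀ W) c‖ ^ 2)
      ≤ Real.exp ((159 * (((P.d + 2) * P.L : ℕ) : ℝ) * Real.sqrt (2 * P.d * (P.L : ℝ) ^ P.d * (2 * P.d))) / Real.sqrt (((P.L : ℝ) ^ P.d)⁻¹ * (P.L : ℝ) ^ 2) * ∑ i ∈ Finset.range k, a i) * (∑ i ∈ Finset.range k, Real.sqrt (((P.L : ℝ) ^ P.d)⁻¹ * (P.L : ℝ) ^ 2) ^ (k - 1 - i) * (260 * (μ i * ((((P.d + 2) * P.L : ℕ) : ℝ) * Real.sqrt (2 * P.d * (P.L : ℝ) ^ P.d * (2 * P.d)) * Real.sqrt (∑ b : PBond P i, ‖(pertVar (Averaging.iter (fun i => blockAvg (P := P) (j := i) (expMeanLogSU (n := Fin N))) i U₀) (Averaging.iter (fun i => blockAvg (P := P) (j := i) (expMeanLogSU (n := Fin N))) i W)) b‖ ^ 2)))))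
        + 2 * Real.sqrt P.d * ∑ j ∈ Finset.range k, Real.sqrt (4 * P.d * (((P.d : ℝ) + 2) ^ 2 * N * (P.L : ℝ) ^ 4) + (4 * ((P.d : ℝ) + 2) ^ 2 * (P.d : ℝ) ^ 3 * (3 * N + 2 * P.d) * (P.L : ℝ) ^ 6) * a' ^ 2) * (Real.exp ((159 * (((P.d + 2) * P.L : ℕ) : ℝ) * Real.sqrt (2 * P.d * (P.L : ℝ) ^ P.d * (2 * P.d))) / Real.sqrt (((P.L : ℝ) ^ P.d)⁻¹ * (P.L : ℝ) ^ 2) * ∑ i ∈ Finset.range j, a i) * (∑ i ∈ Finset.range j, Real.sqrt (((P.L : ℝ) ^ P.d)⁻¹ * (P.L : ℝ) ^ 2) ^ (j - 1 - i) * (260 * (μ i * ((((P.d + 2) * P.L : ℕ) : ℝ) * Real.sqrt (2 * P.d * (P.L : ℝ) ^ P.d * (2 * P.d)) * Real.sqrt (∑ b : PBond P i, ‖(pertVar (Averaging.iter (fun i => blockAvg (P := P) (j := i) (expMeanLogSU (n := Fin N))) i U₀) (Averaging.iter (fun i => blockAvg (P := P) (j := i) (expMeanLogSU (n := Fin N)))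 i W)) b‖ ^ 2)))))) := by
  -- file B with the two-block walk masses
  have hB := sqrt_sum_normSq_trueLinIter_le_of_iter_eq U₀ W hk hfib Q hQ0 hQs a ha0 ha' hα ha24 haN hV
    (fun l c => (((P.d + 2) * P.L : ℕ) : ℝ) * ∑ b ∈ (univ.filter (fun b : PBond P l => blockOf b.src = c.src ∨ blockOf b.src = c.tgt)), ‖(pertVar (Averaging.iter (fun i => blockAvg (P := P) (j := i) (expMeanLogSU (n := Fin N))) l U₀) (Averaging.iter (fun i => blockAvg (P := P) (j := i) (expMeanLogSU (n := Fin N))) l W)) b‖)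
    (fun j hj c i => mass_loop_le (by omega) _ c i) (fun j hj c => mass_segment_le (by omega) _ c)
    (fun j hj c => by linarith [hμ j hj c, hμ72 j hj]) (fun j hj c => by linarith [hμ j hj c, hμN j hj])
  -- the `ℓ⁴` rows, level by level
  have hρ0 : 0 ≤ Real.sqrt (((P.L : ℝ) ^ P.d)⁻¹ * (P.L : ℝ) ^ 2) := Real.sqrt_nonneg _
  have h4 : ∀ l < k, Real.sqrt (∑ c : PBond P (l + 1), ((((P.d + 2) * P.L : ℕ) : ℝ) * ∑ b ∈ (univ.filter (fun b : PBond P l => blockOf b.src = c.src ∨ blockOf b.src = c.tgt)), ‖(pertVar (Averaging.iter (fun i => blockAvg (P := P) (j := i) (expMeanLogSU (n := Fin N))) l U₀) (Averaging.iter (fun i => blockAvg (P := P) (j := i) (expMeanLogSU (n := Fin N))) l W)) b‖) ^ 4)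
      ≤ μ l * ((((P.d + 2) * P.L : ℕ) : ℝ) * Real.sqrt (2 * P.d * (P.L : ℝ) ^ P.d * (2 * P.d)) * Real.sqrt (∑ b : PBond P l, ‖(pertVar (Averaging.iter (fun i => blockAvg (P := P) (j := i) (expMeanLogSU (n := Fin N))) l U₀) (Averaging.iter (fun i => blockAvg (P := P) (j := i) (expMeanLogSU (n := Fin N))) l W)) b‖ ^ 2)) :=
    fun l hl => sqrt_sum_nbhdMass_pow_four_le (N := N) (by omega) _ (hμ0 l hl) (hμ l hl)
  have hS : ∀ j ≤ k,
      (∑ l ∈ Finset.range j, Real.sqrt (((P.L : ℝ) ^ P.d)⁻¹ * (P.L : ℝ) ^ 2) ^ (j - 1 - l) * (260 * Real.sqrt (∑ c : PBond P (l + 1),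
          ((((P.d + 2) * P.L : ℕ) : ℝ) * ∑ b ∈ (univ.filter (fun b : PBond P l => blockOf b.src = c.src ∨ blockOf b.src = c.tgt)), ‖(pertVar (Averaging.iter (fun i => blockAvg (P := P) (j := i) (expMeanLogSU (n := Fin N))) l U₀) (Averaging.iter (fun i => blockAvg (P := P) (j := i) (expMeanLogSU (n := Fin N))) l W)) b‖) ^ 4)))
        ≤ (∑ l ∈ Finset.range j, Real.sqrt (((P.L : ℝ) ^ P.d)⁻¹ * (P.L : ℝ) ^ 2) ^ (j - 1 - l) * (260 * (μ l * ((((P.d + 2) * P.L : ℕ) : ℝ) * Real.sqrt (2 * P.d * (P.L : ℝ) ^ P.d * (2 * P.d)) * Real.sqrt (∑ b : PBond P l, ‖(pertVar (Averaging.iter (fun i => blockAvg (P := P) (j := i) (expMeanLogSU (n := Fin N))) l U₀) (Averaging.iter (fun i => blockAvg (P := P) (j := i) (expMeanLogSU (n := Fin N))) l W)) b‖ ^ 2))))) := by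
    intro j hj
    refine Finset.sum_le_sum fun l hl => ?_
    have hlk : l < k := (Finset.mem_range.mp hl).trans_le hj
    exact mul_le_mul_of_nonneg_left (mul_le_mul_of_nonneg_left (h4 l hlk) (by norm_num)) (pow_nonneg hρ0 _)
  have hE0 : ∀ j, 0 ≤ Real.exp ((159 * (((P.d + 2) * P.L : ℕ) : ℝ) * Real.sqrt (2 * P.d * (P.L : ℝ) ^ P.d * (2 * P.d))) / Real.sqrt (((P.L : ℝ) ^ P.d)⁻¹ * (P.L : ℝ) ^ 2) * ∑ i ∈ Finset.range j, a i) := fun j => (Real.exp_pos _).le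
  have hC0 : 0 ≤ Real.sqrt (4 * P.d * (((P.d : ℝ) + 2) ^ 2 * N * (P.L : ℝ) ^ 4) + (4 * ((P.d : ℝ) + 2) ^ 2 * (P.d : ℝ) ^ 3 * (3 * N + 2 * P.d) * (P.L : ℝ) ^ 6) * a' ^ 2) := Real.sqrt_nonneg _
  refine hB.trans (add_le_add (mul_le_mul_of_nonneg_left (hS k le_rfl) (hE0 k)) ?_)
  refine mul_le_mul_of_nonneg_left (Finset.sum_le_sum fun j hj => ?_) (by positivity)
  exact mul_le_mul_of_nonneg_left (mul_le_mul_of_nonneg_left (hS j (Finset.mem_range.mp hj).le) (hE0 j)) hC0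

end Summit.QuantumFields.YangMills.Theorems.Prop7FibreTrueLinDefectMass

end
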